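import Summits.ValiantsHypothesis.ValiantsHypothesis.Theorems.LacunarySymmetroidMatrixDescartesDoorA26WallBubblingMultiplicityDescartes

/-!
# `DoorA26` / line `wall_bubbling` — HERMITE INTERPOLATION by real exponential sums (unisolvence from Laguerre with multiplicity)

HONEST FRAMING.  Object-search cell `pub-symmetroid`, crux `Theses.LacunarySymmetroid.DoorA26` (stmt-ValiantsHypothesis-19979; OPEN, typed,
never asserted).  W2 seat val-sym-door-p1 g19, file #67; def-free helper for obligation (R) of `Cruxes/DoorA26/Lines/wall_bubbling.lean`:
the order-≥-3 lifts need TEST FUNCTIONS with prescribed Hermite data (values and derivatives at the nodes, the touches and the multiple zero —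
memo `DOOR-A26-P1G19-NO-BALANCE.md` §7c), i.e. the surjectivity of the Hermite evaluation map on a `(K+1)`-term exponential-sum space for
at most `K + 1` conditions.  Imports #64 `…MultiplicityDescartes` (`sum_order_le_of_expSum`, which gives injectivity in the square case).

WHAT IS HERE.  `hermiteEval` (the linear map `a ↦ (f^{(k)}(z))_{z ∈ Z, k < m z}`, `f = expSum a x`) as a term, not a definition;
`exists_expSum_hermite_of_eq` (square case `Σ_{z∈Z} m z = K + 1`: every Hermite datum is attained — injective by #64, hence surjective by
dimension count); ★ `exists_expSum_hermite` (general case `Σ m z ≤ K + 1`, by padding `Z` with fresh simple nodes to the right of `Z`).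
Nothing here bears on `DoorA26`, `DoorA34`, (W)/(M)/(R), `MatrixDescartes` (18050) or `VP ≠ VNP`; registers unchanged.

[folklore] unisolvence of Hermite interpolation in an extended Chebyshev system (Karlin–Studden, *Tchebycheff systems* I §2).  [this work] packaging.
-/

set_option linter.dupNamespace false

namespace Summit.ValiantsHypothesis.ValiantsHypothesis.Theorems.LacunarySymmetroidMatrixDescartes.WallBubbling

open Finset
open Bubbling (expSum)

/-- Square case of HERMITE INTERPOLATION for exponential sums: `K + 1` pairwise distinct exponents, nodes `Z` with multiplicities `m`,
`Σ_{z∈Z} m z = K + 1`; every datum `v` is attained: `f^{(k)}(z) = v z k` for `z ∈ Z`, `k < m z`. [folklore] -/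
theorem exists_expSum_hermite_of_eq (K : ℕ) (x : Fin (K + 1) → ℝ) (hx : Function.Injective x) (Z : Finset ℝ) (m : ℝ → ℕ)
    (hm : ∑ z ∈ Z, m z = K + 1) (v : ℝ → ℕ → ℝ) :
    ∃ a : Fin (K + 1) → ℝ, ∀ z ∈ Z, ∀ k < m z, iteratedDeriv k (expSum a x) z = v z k := by
  classical
  -- index type of the Hermite conditions
  let J := Σ z : Z, Fin (m z)
  have hcard : Fintype.card J = K + 1 := by
    rw [Fintype.card_sigma]
    simp only [Fintype.card_fin]
    rw [← hm, ← Finset.sum_coe_sort Z]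
  -- the Hermite evaluation map, linear in the coefficients
  let L : (Fin (K + 1) → ℝ) →ₗ[ℝ] (J → ℝ) :=
    { toFun := fun a j => ∑ i, (a i * Real.exp (x i * (j.1 : ℝ))) * x i ^ (j.2 : ℕ)
      map_add' := fun a b => by
        funext j
        simp only [Pi.add_apply, ← Finset.sum_add_distrib]
        exact Finset.sum_congr rfl fun i _ => by ring
      map_smul' := fun c a => by
        funext j
        simp only [Pi.smul_apply, smul_eq_mul, RingHom.id_apply, Finset.mul_sum]
        exact Finset.sum_congr rfl fun i _ => by ring }
  have hL : ∀ a (j : J), L a j = iteratedDeriv (j.2 : ℕ) (expSum a x) (j.1 : ℝ) := fun a j => by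
    rw [iteratedDeriv_expSum_apply]; rfl
  -- injective by Laguerre with multiplicity
  have hinj : Function.Injective L := by
    rw [← LinearMap.ker_eq_bot, LinearMap.ker_eq_bot']
    intro a ha
    by_contra hne
    have hvan : ∀ z ∈ Z, ∀ k < m z, iteratedDeriv k (expSum a x) z = 0 := fun z hz k hk => by
      have := congrArg (fun f => f ⟨⟨z, hz⟩, ⟨k, hk⟩⟩) ha
      simpa [hL] using this
    have := sum_order_le_of_expSum K x hx a hne Z m hvan
    omega
  have hfin : Module.finrank ℝ (Fin (K + 1) → ℝ) = Module.finrank ℝ (J → ℝ) := by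
    rw [Module.finrank_fintype_fun_eq_card, Module.finrank_fintype_fun_eq_card, Fintype.card_fin, hcard]
  have hsurj : Function.Surjective L := (LinearMap.injective_iff_surjective_of_finrank_eq_finrank hfin).1 hinj
  obtain ⟨a, ha⟩ := hsurj fun j => v (j.1 : ℝ) (j.2 : ℕ)
  refine ⟨a, fun z hz k hk => ?_⟩
  have := congrArg (fun f => f ⟨⟨z, hz⟩, ⟨k, hk⟩⟩) ha
  simpa [hL] using this

/-- ★ HERMITE INTERPOLATION for exponential sums: `K + 1` pairwise distinct exponents, nodes `Z` with multiplicities `m`, `Σ_{z∈Z} m z ≤ K + 1`;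
every datum is attained (`f^{(k)}(z) = v z k` for `z ∈ Z`, `k < m z`).  Padding: `K + 1 − Σ m` fresh simple nodes to the right of `Z`. [folklore] -/
theorem exists_expSum_hermite (K : ℕ) (x : Fin (K + 1) → ℝ) (hx : Function.Injective x) (Z : Finset ℝ) (m : ℝ → ℕ)
    (hm : ∑ z ∈ Z, m z ≤ K + 1) (v : ℝ → ℕ → ℝ) :
    ∃ a : Fin (K + 1) → ℝ, ∀ z ∈ Z, ∀ k < m z, iteratedDeriv k (expSum a x) z = v z k := by
  classical
  -- a strict upper bound for `Z`
  obtain ⟨M, hM⟩ : ∃ M : ℝ, ∀ z ∈ Z, z < M := by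
    rcases Z.eq_empty_or_nonempty with h | h
    · exact ⟨0, by simp [h]⟩
    · exact ⟨Z.max' h + 1, fun z hz => lt_of_le_of_lt (Z.le_max' z hz) (lt_add_one _)⟩
  set r := K + 1 - ∑ z ∈ Z, m z with hr
  -- the padding nodes `M, M+1, …, M+r-1`
  let P : Finset ℝ := (Finset.range r).image fun i : ℕ => M + (i : ℝ)
  have hPcard : P.card = r := by
    rw [Finset.card_image_of_injective _ (fun (i : ℕ) (j : ℕ) (h : M + (i : ℝ) = M + (j : ℝ)) => by exact_mod_cast (add_right_inj M).1 h),
      Finset.card_range]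
  have hdisj : Disjoint Z P := by
    rw [Finset.disjoint_left]
    intro z hz hzP
    obtain ⟨i, -, rfl⟩ := Finset.mem_image.1 hzP
    have := hM _ hz
    have hi : (0 : ℝ) ≤ (i : ℝ) := Nat.cast_nonneg i
    linarith
  let m' : ℝ → ℕ := fun z => if z ∈ Z then m z else 1
  have hsum : ∑ z ∈ Z ∪ P, m' z = K + 1 := by
    rw [Finset.sum_union hdisj]
    have h1 : ∑ z ∈ Z, m' z = ∑ z ∈ Z, m z := Finset.sum_congr rfl fun z hz => by simp [m', hz]
    have h2 : ∑ z ∈ P, m' z = ∑ z ∈ P, 1 := Finset.sum_congr rfl fun z hz => by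
      simp [m', Finset.disjoint_right.1 hdisj hz]
    rw [h1, h2, Finset.sum_const, smul_eq_mul, mul_one, hPcard, hr]
    omega
  obtain ⟨a, ha⟩ := exists_expSum_hermite_of_eq K x hx (Z ∪ P) m' hsum v
  refine ⟨a, fun z hz k hk => ha z (Finset.mem_union_left _ hz) k ?_⟩
  simpa [m', hz] using hk

end Summit.ValiantsHypothesis.ValiantsHypothesis.Theorems.LacunarySymmetroidMatrixDescartes.WallBubbling
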